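/-
Copyright (c) 2026. All rights reserved.
Released under Apache 2.0 license as described in the file LICENSE.
Authors: abc-iut cell, wave-4 seat abc-iut-w4-d059 (proof-only; input `hrigid` of row T54-0b: commensurable
verticial subgroups are equal, from [SemiAnbd] Thm 3.7 (ii)).
-/
import Mathlib.GroupTheory.Commensurable
import Literature.AnabelianGeometry.SemiGraphs.TemperedMaximalCompact
import Literature.AnabelianGeometry.SemiGraphs.TemperedVerticialDistinctSameVertex
import HarnessLib

/-!
# [SemiAnbd] Thm 3.7 (ii): commensurable verticial subgroups of `π₁^temp(𝒢)` coincide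

Mochizuki, *Semi-graphs of anabelioids*, Publ. RIMS **42** (2006), §3, Theorem 3.7 (ii) p. 40 of the
author's manuscript [cite: MochizukiSemiAnbd2006, Thm 3.7 (ii), p. 40]: "if `H₁`, `H₂` are verticial
subgroups of `π₁^temp(𝒢)` that arise from distinct parametrization data, then `H₁ ∩ H₂` has infinite index
in `H₁`. In particular, verticial subgroups that arise from distinct parametrization data are distinct."

PROOF-ONLY (no definition): the form consumed by the commensurator description of the arithmetic
decomposition groups ([SemiAnbd] §5 p. 65 "[Cor 2.7 (i), (iii); Prop 3.6 (iii)]"; sub-DAG Thm 5.4 row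
T54-0b, binder `hrigid` of `mem_commensurator_map_iff_fixes`): GIVEN the named fact `VerticialDistinct`
(DISCHARGED in the tree, `verticialDistinct_holds`), two COMMENSURABLE verticial subgroups (at any two
vertices) are EQUAL — distinct vertices give index `0`, and at one vertex the two are conjugate by some
`g` (Prop 3.2, `exists_conj_of_mem_verticialSubgroups`) which must lie in the subgroup, again by index `0`
otherwise. Nothing here bears on [IUTchIII] Cor. 3.12.
-/

namespace Literature.AnabelianGeometry.SemiGraphs

namespace ProfiniteSemiGraph

open CategoryTheory

universe u

variable {𝒢 : ProfiniteSemiGraph.{u}}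

/-- Conjugating a subgroup by one of its own elements does nothing. [folklore] -/
private theorem map_conj_eq_self_of_mem' {Γ : Type u} [Group Γ] {H : Subgroup Γ} {g : Γ} (hg : g ∈ H) :
    H.map (MulAut.conj g).toMonoidHom = H := by
  ext x
  simp only [Subgroup.mem_map, MulEquiv.coe_toMonoidHom, MulAut.conj_apply]
  constructor
  · rintro ⟨y, hy, rfl⟩; exact H.mul_mem (H.mul_mem hg hy) (H.inv_mem hg)
  · intro hx; exact ⟨g⁻¹ * x * g, H.mul_mem (H.mul_mem (H.inv_mem hg) hx) hg, by group⟩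

/-- **Commensurable verticial subgroups are equal** ([SemiAnbd] Thm 3.7 (ii), commensurator form; the
input `hrigid` of the commensurator description of the arithmetic decomposition groups, §5 p. 65): under
`VerticialDistinct`, if `H ∈ verticialSubgroups c v` and `H' ∈ verticialSubgroups c v'` are commensurable
then `H = H'` (and `v = v'`). [cite: MochizukiSemiAnbd2006, Thm 3.7 (ii), p. 40] -/
theorem eq_of_commensurable_of_mem_verticialSubgroups (hVD : VerticialDistinct.{u})
    (h𝒢 : 𝒢.Thm37Hypotheses) (c : TemperedPiChart 𝒢) {v v' : 𝒢.graph.Vertex} {H H' : Subgroup c.G}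
    (hH : H ∈ verticialSubgroups c v) (hH' : H' ∈ verticialSubgroups c v')
    (hc : Subgroup.Commensurable H H') : v = v' ∧ H = H' := by
  -- distinct vertices are excluded by clause 1 (index `0`)
  have hvv : v = v' := by
    by_contra hne
    exact hc.2 ((hVD 𝒢 h𝒢 c).1 v v' H H' hH hH' hne)
  subst hvv
  refine ⟨rfl, ?_⟩
  -- at one vertex the two are conjugate: `H' = g H g⁻¹`
  obtain ⟨g, rfl⟩ := exists_conj_of_mem_verticialSubgroups c hH hH'
  -- `g ∈ H`, else clause 2 gives index `0`
  have hg : g ∈ H := by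
    by_contra hg
    have h0 := (hVD 𝒢 h𝒢 c).2 v H hH 1 g (by rwa [inv_one, one_mul])
    rw [map_conj_eq_self_of_mem' H.one_mem] at h0
    exact hc.2 h0
  exact (map_conj_eq_self_of_mem' hg).symm

/-- The same for verticial subgroups regarded as ONE family (the binder `hrigid` of
`mem_commensurator_map_iff_fixes` with `VN := {H | ∃ v, H ∈ verticialSubgroups c v}`).
[cite: MochizukiSemiAnbd2006, Thm 3.7 (ii), p. 40] -/
theorem verticial_commensurable_rigid (hVD : VerticialDistinct.{u}) (h𝒢 : 𝒢.Thm37Hypotheses)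
    (c : TemperedPiChart 𝒢) :
    ∀ H ∈ {H : Subgroup c.G | ∃ v, H ∈ verticialSubgroups c v},
      ∀ H' ∈ {H : Subgroup c.G | ∃ v, H ∈ verticialSubgroups c v},
        Subgroup.Commensurable H H' → H = H' := by
  rintro H ⟨v, hH⟩ H' ⟨v', hH'⟩ hc
  exact (eq_of_commensurable_of_mem_verticialSubgroups hVD h𝒢 c hH hH' hc).2

/-- **Unconditional form** (Thm 3.7 (ii) is DISCHARGED in the tree: `verticialDistinct_holds`,
abc-iut-L3-t8): commensurable verticial subgroups of `π₁^temp(𝒢)` coincide, for every `𝒢` satisfying the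
hypotheses of Thm 3.7 and every chart. [cite: MochizukiSemiAnbd2006, Thm 3.7 (ii), p. 40] -/
theorem eq_of_commensurable_of_mem_verticialSubgroups' (h𝒢 : 𝒢.Thm37Hypotheses) (c : TemperedPiChart 𝒢)
    {v v' : 𝒢.graph.Vertex} {H H' : Subgroup c.G} (hH : H ∈ verticialSubgroups c v)
    (hH' : H' ∈ verticialSubgroups c v') (hc : Subgroup.Commensurable H H') : v = v' ∧ H = H' :=
  eq_of_commensurable_of_mem_verticialSubgroups verticialDistinct_holds h𝒢 c hH hH' hc

end ProfiniteSemiGraph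

end Literature.AnabelianGeometry.SemiGraphs
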